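import Summits.HubbardSuperconductivity.HubbardSuperconductivity.Theorems.KacWindowPenaltyWindowGapPenalisedForms
import Literature.MathematicalPhysics.QuantumLattice.DWaveSource

/-!
# Sketch — crux idea `sector-invisible-dressing` for crux `KacWindowPenalty.WindowGap`
# (stmt-HubbardSuperconductivity-1088), crux-ideate round 1, ideator 1

First lemma (PROVED here, abstract finite-dimensional form): the SECTOR-INVISIBLE DRESSING bridge.
If `S` has vanishing quadratic form on the sector `K` (e.g. chemical shift `-μ(N̂-N_L)`, Kac
charging `(κ/L²)(N̂-N_L)²`, d-wave pair source `-h(Δ+Δᴴ)`), if `W` dominates `|⟨A⟩|²/c`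
(Cauchy–Schwarz: the Kac window contains the `m = 0` mode, `W_ε ≥ L⁻² ΔᴴΔ`), and if every ground
state of the DRESSED penalised operator `X + λW + S` on the ambient space `K'` has `Re ⟨A⟩ ≥ m ≥ 0`,
then `minEnergyOn (X + λW) K ≥ minEnergyOn (X + S) K' + λ m²/c`.

Concrete statements (elaborated, not proved): the dressed Hubbard torus, the transfer target
`ChargedSourcedWindowOrder` (robust sourced d-wave pair amplitude of the charged, window-repelled,
sourced grand-canonical Hubbard torus), the two provable-now supports `ChargingFloor`,
`SourceRemoval`, and the composition shape `Transfer … → WindowGap`.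
-/

set_option linter.dupNamespace false

namespace Summit.HubbardSuperconductivity.HubbardSuperconductivity.Cruxes.WindowGap.SectorInvisibleDressing

open Matrix Literature.MathematicalPhysics.QuantumLattice
open Summit.HubbardSuperconductivity.HubbardSuperconductivity.Theorems
  (minEnergyOn_le_re_rayleigh exists_unit_re_rayleigh_eq_minEnergyOn)
open Summit.HubbardSuperconductivity.HubbardSuperconductivity.Theses.KacWindowPenalty (WindowGap)

section Abstract

variable {n : Type*} [Fintype n]

/-- **First lemma (sector-invisible dressing + source-pinned Cauchy–Schwarz), PROVED.**
`X` the Hamiltonian, `W` the (window) penalty, `S` a dressing with zero quadratic form on the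
sector `K ≤ K'`, `A` the order field with `(Re ⟨φ, Aφ⟩)²/c ≤ Re ⟨φ, Wφ⟩` on unit vectors of `K'`.
If every unit minimiser `φ ∈ K'` of the dressed penalised operator `X + λW + S` has
`m ≤ Re ⟨φ, A φ⟩` (`0 ≤ m`, `0 ≤ λ`), then
`minEnergyOn (X + S) K' + λ m² / c ≤ minEnergyOn (X + λ W) K`.
Proof: sector trial vectors do not see `S`, so the dressed `K'`-energy is below the sector energy
of `X + λW`; at a dressed minimiser `φ`, the variational principle for `X + S` and
`λ Re⟨φ,Wφ⟩ ≥ λ (Re⟨φ,Aφ⟩)²/c ≥ λ m²/c` finish. [folklore pieces; the combination is the card] -/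
theorem dressedBridge (X W S A : Matrix n n ℂ) (K K' : Submodule ℂ (n → ℂ)) (hKK' : K ≤ K')
    (hK : ∃ ψ ∈ K, star ψ ⬝ᵥ ψ = 1)
    (hS : ∀ ψ ∈ K, star ψ ⬝ᵥ ψ = 1 → (star ψ ⬝ᵥ S *ᵥ ψ).re = 0)
    {c lam m : ℝ} (hc : 0 < c) (hlam : 0 ≤ lam) (hm : 0 ≤ m)
    (hWA : ∀ φ ∈ K', star φ ⬝ᵥ φ = 1 →
      (star φ ⬝ᵥ A *ᵥ φ).re ^ 2 / c ≤ (star φ ⬝ᵥ W *ᵥ φ).re)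
    (hGS : ∀ φ ∈ K', star φ ⬝ᵥ φ = 1 →
      (star φ ⬝ᵥ (X + (lam : ℂ) • W + S) *ᵥ φ).re = (X + (lam : ℂ) • W + S).minEnergyOn K' →
        m ≤ (star φ ⬝ᵥ A *ᵥ φ).re) :
    (X + S).minEnergyOn K' + lam * m ^ 2 / c ≤ (X + (lam : ℂ) • W).minEnergyOn K := by
  obtain ⟨ψ₀, hψ₀K, hψ₀⟩ := hK
  -- a dressed minimiser on the ambient space
  obtain ⟨φ, hφK', hφ, hmin⟩ :=
    exists_unit_re_rayleigh_eq_minEnergyOn (X + (lam : ℂ) • W + S) K' ⟨ψ₀, hKK' hψ₀K, hψ₀⟩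
  -- step 1 : the dressed ambient energy is below the sector energy (S is invisible on K)
  have step1 : (X + (lam : ℂ) • W + S).minEnergyOn K' ≤ (X + (lam : ℂ) • W).minEnergyOn K := by
    refine le_csInf ⟨_, ψ₀, hψ₀K, hψ₀, rfl⟩ ?_
    rintro E ⟨ψ, hψK, hψ, rfl⟩
    have hv := minEnergyOn_le_re_rayleigh (X + (lam : ℂ) • W + S) K' (hKK' hψK) hψ
    rw [add_mulVec (X + (lam : ℂ) • W) S, dotProduct_add, Complex.add_re, hS ψ hψK hψ,
      add_zero] at hv
    exact hv
  -- step 2 : variational principle for X + S at φ, Cauchy–Schwarz domination, order floor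
  have hXS := minEnergyOn_le_re_rayleigh (X + S) K' hφK' hφ
  have hW := hWA φ hφK' hφ
  have hA := hGS φ hφK' hφ hmin
  have e1 : (star φ ⬝ᵥ (X + (lam : ℂ) • W + S) *ᵥ φ).re =
      (star φ ⬝ᵥ X *ᵥ φ).re + lam * (star φ ⬝ᵥ W *ᵥ φ).re + (star φ ⬝ᵥ S *ᵥ φ).re := by
    rw [add_mulVec, add_mulVec, dotProduct_add, dotProduct_add, Complex.add_re, Complex.add_re,
      smul_mulVec, dotProduct_smul, smul_eq_mul, Complex.re_ofReal_mul]
  have e2 : (star φ ⬝ᵥ (X + S) *ᵥ φ).re = (star φ ⬝ᵥ X *ᵥ φ).re + (star φ ⬝ᵥ S *ᵥ φ).re := by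
    rw [add_mulVec, dotProduct_add, Complex.add_re]
  have hm2 : m ^ 2 ≤ (star φ ⬝ᵥ A *ᵥ φ).re ^ 2 := pow_le_pow_left₀ hm hA 2
  have hm3 : m ^ 2 / c ≤ (star φ ⬝ᵥ W *ᵥ φ).re :=
    (div_le_div_of_nonneg_right hm2 hc.le).trans hW
  have hm4 : lam * (m ^ 2 / c) ≤ lam * (star φ ⬝ᵥ W *ᵥ φ).re :=
    mul_le_mul_of_nonneg_left hm3 hlam
  rw [mul_div_assoc]
  linarith [step1, hXS, e1, e2, hm4, hmin]



/-- **Split bridge (PROVED): unpenalised sourced order + no window kink.** Same data as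
`dressedBridge`, but the order floor is asked of the ground states `φ₀` of the UNPENALISED dressed
operator `X + S` (`m ≤ Re ⟨φ₀, A φ₀⟩`), and the penalty enters only through the one-sided
WINDOW-WEIGHT PERSISTENCE `Re ⟨φ₀, W φ₀⟩ - Re ⟨φ, W φ⟩ ≤ k` between ground states of `X + S` and of
`X + λW + S` ("no kink at λ = 0⁺ in the U(1)-invariant window direction"). Then
`minEnergyOn (X + S) K' + λ (m²/c - k) ≤ minEnergyOn (X + λW) K`. -/
theorem splitBridge (X W S A : Matrix n n ℂ) (K K' : Submodule ℂ (n → ℂ)) (hKK' : K ≤ K')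
    (hK : ∃ ψ ∈ K, star ψ ⬝ᵥ ψ = 1)
    (hS : ∀ ψ ∈ K, star ψ ⬝ᵥ ψ = 1 → (star ψ ⬝ᵥ S *ᵥ ψ).re = 0)
    {c lam m k : ℝ} (hc : 0 < c) (hlam : 0 ≤ lam) (hm : 0 ≤ m)
    (hWA : ∀ φ ∈ K', star φ ⬝ᵥ φ = 1 →
      (star φ ⬝ᵥ A *ᵥ φ).re ^ 2 / c ≤ (star φ ⬝ᵥ W *ᵥ φ).re)
    (hOrd : ∀ φ₀ ∈ K', star φ₀ ⬝ᵥ φ₀ = 1 →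
      (star φ₀ ⬝ᵥ (X + S) *ᵥ φ₀).re = (X + S).minEnergyOn K' → m ≤ (star φ₀ ⬝ᵥ A *ᵥ φ₀).re)
    (hKink : ∀ φ₀ ∈ K', star φ₀ ⬝ᵥ φ₀ = 1 →
      (star φ₀ ⬝ᵥ (X + S) *ᵥ φ₀).re = (X + S).minEnergyOn K' →
      ∀ φ ∈ K', star φ ⬝ᵥ φ = 1 →
        (star φ ⬝ᵥ (X + (lam : ℂ) • W + S) *ᵥ φ).re = (X + (lam : ℂ) • W + S).minEnergyOn K' →
          (star φ₀ ⬝ᵥ W *ᵥ φ₀).re - (star φ ⬝ᵥ W *ᵥ φ).re ≤ k) :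
    (X + S).minEnergyOn K' + lam * (m ^ 2 / c - k) ≤ (X + (lam : ℂ) • W).minEnergyOn K := by
  obtain ⟨ψ₀, hψ₀K, hψ₀⟩ := hK
  obtain ⟨φ, hφK', hφ, hmin⟩ :=
    exists_unit_re_rayleigh_eq_minEnergyOn (X + (lam : ℂ) • W + S) K' ⟨ψ₀, hKK' hψ₀K, hψ₀⟩
  obtain ⟨φ₀, hφ₀K', hφ₀, hmin₀⟩ :=
    exists_unit_re_rayleigh_eq_minEnergyOn (X + S) K' ⟨ψ₀, hKK' hψ₀K, hψ₀⟩
  have step1 : (X + (lam : ℂ) • W + S).minEnergyOn K' ≤ (X + (lam : ℂ) • W).minEnergyOn K := by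
    refine le_csInf ⟨_, ψ₀, hψ₀K, hψ₀, rfl⟩ ?_
    rintro E ⟨ψ, hψK, hψ, rfl⟩
    have hv := minEnergyOn_le_re_rayleigh (X + (lam : ℂ) • W + S) K' (hKK' hψK) hψ
    rw [add_mulVec (X + (lam : ℂ) • W) S, dotProduct_add, Complex.add_re, hS ψ hψK hψ,
      add_zero] at hv
    exact hv
  have hXS := minEnergyOn_le_re_rayleigh (X + S) K' hφK' hφ
  have hW0 := hWA φ₀ hφ₀K' hφ₀
  have hA0 := hOrd φ₀ hφ₀K' hφ₀ hmin₀
  have hk := hKink φ₀ hφ₀K' hφ₀ hmin₀ φ hφK' hφ hmin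
  have e1 : (star φ ⬝ᵥ (X + (lam : ℂ) • W + S) *ᵥ φ).re =
      (star φ ⬝ᵥ X *ᵥ φ).re + lam * (star φ ⬝ᵥ W *ᵥ φ).re + (star φ ⬝ᵥ S *ᵥ φ).re := by
    rw [add_mulVec, add_mulVec, dotProduct_add, dotProduct_add, Complex.add_re, Complex.add_re,
      smul_mulVec, dotProduct_smul, smul_eq_mul, Complex.re_ofReal_mul]
  have e2 : (star φ ⬝ᵥ (X + S) *ᵥ φ).re = (star φ ⬝ᵥ X *ᵥ φ).re + (star φ ⬝ᵥ S *ᵥ φ).re := by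
    rw [add_mulVec, dotProduct_add, Complex.add_re]
  have hm2 : m ^ 2 ≤ (star φ₀ ⬝ᵥ A *ᵥ φ₀).re ^ 2 := pow_le_pow_left₀ hm hA0 2
  have hm3 : m ^ 2 / c ≤ (star φ₀ ⬝ᵥ W *ᵥ φ₀).re :=
    (div_le_div_of_nonneg_right hm2 hc.le).trans hW0
  have hm4 : lam * (m ^ 2 / c - k) ≤ lam * (star φ ⬝ᵥ W *ᵥ φ).re :=
    mul_le_mul_of_nonneg_left (by linarith) hlam
  linarith [step1, hXS, e1, e2, hm4, hmin]

/-- **Window monotonicity (PROVED).** If `Re ⟨ψ, W̃ ψ⟩ ≤ Re ⟨ψ, W ψ⟩` on the unit vectors of `K`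
(e.g. `W̃ = L⁻² Σ_m β(q_m/ε) Δ(m)ᴴΔ(m)` a smooth SUB-window, `0 ≤ β ≤ 1_{B₁}`, `β(0) = 1`, against the
crux's sharp window `W = W_ε`) and `0 ≤ λ`, then `minEnergyOn (X + λ W̃) K ≤ minEnergyOn (X + λ W) K`:
a chord floor for the smooth, quasi-local (Schwartz-kernel) Kac penalty implies the crux's. -/
theorem minEnergyOn_add_smul_mono (X W W' : Matrix n n ℂ) (K : Submodule ℂ (n → ℂ))
    (hK : ∃ ψ ∈ K, star ψ ⬝ᵥ ψ = 1) {lam : ℝ} (hlam : 0 ≤ lam)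
    (hWW : ∀ ψ ∈ K, star ψ ⬝ᵥ ψ = 1 → (star ψ ⬝ᵥ W' *ᵥ ψ).re ≤ (star ψ ⬝ᵥ W *ᵥ ψ).re) :
    (X + (lam : ℂ) • W').minEnergyOn K ≤ (X + (lam : ℂ) • W).minEnergyOn K := by
  obtain ⟨ψ₀, hψ₀K, hψ₀⟩ := hK
  refine le_csInf ⟨_, ψ₀, hψ₀K, hψ₀, rfl⟩ ?_
  rintro E ⟨ψ, hψK, hψ, rfl⟩
  have hv := minEnergyOn_le_re_rayleigh (X + (lam : ℂ) • W') K hψK hψ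
  have hle := mul_le_mul_of_nonneg_left (hWW ψ hψK hψ) hlam
  rw [add_mulVec, dotProduct_add, Complex.add_re, smul_mulVec, dotProduct_smul, smul_eq_mul,
    Complex.re_ofReal_mul] at hv ⊢
  linarith

end Abstract

/-! ### Concrete objects on the Hubbard torus -/

section Concrete

/-- The crux's Kac-window pair penalty `W_ε` in the `pairFieldAt` spelling (rfl-equal to the
crux's `let W`, cf. `Theorems/KacWindowPenaltyWindowGapPenalisedForms`). -/
noncomputable def kacWindow (L : ℕ) [NeZero L] (ε : ℝ) :
    Matrix (Finset (Orb (FermionTorus 2 L))) (Finset (Orb (FermionTorus 2 L))) ℂ :=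
  ∑ m : Fin 2 → ZMod L,
    if (2 * Real.pi / (L : ℝ)) ^ 2 * (∑ i : Fin 2, (((m i).valMinAbs : ℤ) : ℝ) ^ 2) ≤ ε ^ 2 then
      ((L : ℂ) ^ 2)⁻¹ • ((pairFieldAt dWaveFormFactor L m)ᴴ * pairFieldAt dWaveFormFactor L m)
    else 0


/-- A smooth SUB-window penalty `W̃_ε = L⁻² Σ_m β(|q_m|²/ε²) Δ(m)ᴴΔ(m)` with a multiplier
`β : ℝ → ℝ`, intended `0 ≤ β ≤ 1`, `β = 0` off `[0,1]`, `β(0) = 1`, smooth: then `W̃_ε ≤ W_ε` as forms,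
the `m = 0` mode keeps weight `1`, and the real-space kernel is Schwartz at scale `1/ε` (the sharp
window's Bessel kernel `ε J₁(εr)/(2πr) ~ r^{-3/2}` is not `ℓ¹`). -/
noncomputable def smoothKacWindow (L : ℕ) [NeZero L] (β : ℝ → ℝ) (ε : ℝ) :
    Matrix (Finset (Orb (FermionTorus 2 L))) (Finset (Orb (FermionTorus 2 L))) ℂ :=
  ∑ m : Fin 2 → ZMod L,
    ((β ((2 * Real.pi / (L : ℝ)) ^ 2 * (∑ i : Fin 2, (((m i).valMinAbs : ℤ) : ℝ) ^ 2) / ε ^ 2) : ℝ) : ℂ) •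
      (((L : ℂ) ^ 2)⁻¹ • ((pairFieldAt dWaveFormFactor L m)ᴴ * pairFieldAt dWaveFormFactor L m))

/-- Total particle number on the torus (the tree's `totalNumber`, type pinned). -/
noncomputable abbrev Ntot (L : ℕ) [NeZero L] :
    Matrix (Finset (Orb (FermionTorus 2 L))) (Finset (Orb (FermionTorus 2 L))) ℂ :=
  totalNumber

/-- The SECTOR-INVISIBLE DRESSING: chemical shift `-μ(N̂ - N_t)`, Kac charging
`(κ/L²)(N̂ - N_t)²`, d-wave pair source `-h(Δ + Δᴴ)` (`Δ = pairField dWaveFormFactor L`, the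
`m = 0` window mode). Each term has zero quadratic form on `szSector N_t 0`. -/
noncomputable def dressing (L : ℕ) [NeZero L] (Nt : ℕ) (μ κ h : ℝ) :
    Matrix (Finset (Orb (FermionTorus 2 L))) (Finset (Orb (FermionTorus 2 L))) ℂ :=
  -((μ : ℂ) • (Ntot L - (Nt : ℂ) • 1)) +
    ((κ / (L : ℝ) ^ 2 : ℝ) : ℂ) • ((Ntot L - (Nt : ℂ) • 1) * (Ntot L - (Nt : ℂ) • 1)) -
    (h : ℂ) • (pairField dWaveFormFactor L + (pairField dWaveFormFactor L)ᴴ)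

/-- The charged, window-repelled, d-wave-sourced grand-canonical Hubbard torus
`H_U + λ W_ε + dressing` (syntactically `X + λ•W + S` of `dressedBridge`). -/
noncomputable def dressedHubbard (L : ℕ) [NeZero L] (U : ℝ) (Nt : ℕ) (μ κ h lam ε : ℝ) :
    Matrix (Finset (Orb (FermionTorus 2 L))) (Finset (Orb (FermionTorus 2 L))) ℂ :=
  hubbardTorus 2 L 1 U + (lam : ℂ) • kacWindow L ε + dressing L Nt μ κ h

/-- **Transfer target (B-ch): CHARGED SOURCED WINDOW ORDER at `(U, δ, μ)`.** There are an order
floor `m⋆ > 0`, a penalty slope `c_λ > 0` and `ε₁ > 0` such that for every window radius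
`ε ∈ (0, ε₁]`, with penalty `λ = c_λ ε²`, source `h = λ m⋆² / 64` and charging
`κ = (4 + U + |μ|)² / (λ m⋆²)`, eventually in even `L` EVERY unit ground state `φ` (whole Fock
space) of the dressed torus has d-wave pair amplitude `Re ⟨φ, Δ φ⟩ ≥ m⋆ L²`.
Bogoliubov quasi-average order, robust under the weak Kac-window repulsion, in Anderson's
canonical dress (charging pins `N̂` to `N_L ± O(1)` fluctuations... at `O(1)`-in-`L` cost). -/
def ChargedSourcedWindowOrder (U δ μ : ℝ) : Prop :=
  ∃ mstar cl ε₁ : ℝ, 0 < mstar ∧ 0 < cl ∧ 0 < ε₁ ∧ ∀ ε ∈ Set.Ioc (0 : ℝ) ε₁,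
    ∃ L₀ : ℕ, ∀ (L : ℕ) [NeZero L], L₀ ≤ L → Even L →
      ∀ φ : Fock (Orb (FermionTorus 2 L)), star φ ⬝ᵥ φ = 1 →
        (star φ ⬝ᵥ dressedHubbard L U (2 * ⌊(1 - δ) * (L : ℝ) ^ 2 / 2⌋₊) μ
              ((4 + U + |μ|) ^ 2 / (cl * ε ^ 2 * mstar ^ 2)) (cl * ε ^ 2 * mstar ^ 2 / 64)
              (cl * ε ^ 2) ε *ᵥ φ).re =
          (dressedHubbard L U (2 * ⌊(1 - δ) * (L : ℝ) ^ 2 / 2⌋₊) μ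
              ((4 + U + |μ|) ^ 2 / (cl * ε ^ 2 * mstar ^ 2)) (cl * ε ^ 2 * mstar ^ 2 / 64)
              (cl * ε ^ 2) ε).minEnergyOn ⊤ →
        mstar * (L : ℝ) ^ 2 ≤ (star φ ⬝ᵥ pairField dWaveFormFactor L *ᵥ φ).re

/-- **Support (provable now): CHARGING FLOOR.** The chemically shifted, Kac-charged Hubbard torus
on the whole Fock space lies at most `(4 + U + |μ|)² L² / (4κ)` below the `(N_t, S^z = 0)` sector
energy: one-particle addition/removal changes the optimal energy by at most `4 + U` (`t = 1`),
`SU(2)` lowering puts the `N_t`-particle optimum in `S^z = 0`, and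
`max_t [(4+U+|μ|)|t| - κ t²/L²] = (4+U+|μ|)² L²/(4κ)`. -/
def ChargingFloor (U : ℝ) : Prop :=
  0 ≤ U → ∀ (L : ℕ) [NeZero L] (Nt : ℕ) (μ κ : ℝ), Even Nt → Nt ≤ L ^ 2 → 0 < κ →
    (hubbardTorus 2 L 1 U).minEnergyOn (szSector Nt 0) -
        (4 + U + |μ|) ^ 2 * (L : ℝ) ^ 2 / (4 * κ) ≤
      (hubbardTorus 2 L 1 U + (-((μ : ℂ) • (Ntot L - (Nt : ℂ) • 1)) +
        ((κ / (L : ℝ) ^ 2 : ℝ) : ℂ) • ((Ntot L - (Nt : ℂ) • 1) * (Ntot L - (Nt : ℂ) • 1)))).minEnergyOn ⊤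

/-- **Support (provable now): SOURCE REMOVAL.** Switching on the pair source lowers any
whole-space ground energy by at most `h ‖Δ + Δᴴ‖ ≤ 8√2 h L²` (`‖Δ‖ ≤ 4√2 L²` from the Parseval
ceiling `Re⟨ψ, W_ε ψ⟩ ≤ 32 L²` and `W_ε ≥ L⁻² ΔᴴΔ`). -/
def SourceRemoval : Prop :=
  ∀ (L : ℕ) [NeZero L]
    (Y : Matrix (Finset (Orb (FermionTorus 2 L))) (Finset (Orb (FermionTorus 2 L))) ℂ) (h : ℝ),
    0 ≤ h →
      Y.minEnergyOn ⊤ - 8 * Real.sqrt 2 * h * (L : ℝ) ^ 2 ≤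
        (Y - (h : ℂ) • (pairField dWaveFormFactor L + (pairField dWaveFormFactor L)ᴴ)).minEnergyOn ⊤

/-- **Composition shape for crux-plan** (`WindowGap_of`): the two provable supports and the one
constructive stub give the crux by `dressedBridge` with `X = H_U`, `W = W_ε`, `c = L²`,
`S = dressing`, `A = Δ`, `K = szSector N_L 0`, `K' = ⊤`, `m = m⋆ L²`:
`gap ≥ λ m⋆² L² - 8√2 h L² - (4+U+|μ|)² L²/(4κ) = λ m⋆² L² (1 - √2/8 - 1/4) ≥ λ (Cε + m⋆²/4) L²`
once `ε ≤ m⋆²/(4C + 4)`. -/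
def Transfer : Prop :=
  (∀ U : ℝ, ChargingFloor U) → SourceRemoval →
    (∃ U : ℝ, 0 < U ∧ ∃ δ ∈ Set.Ioo (0 : ℝ) (1 / 2), ∃ μ : ℝ, ChargedSourcedWindowOrder U δ μ) →
      WindowGap


/-- **Split stub (S-A1) at size `L`: CHARGED SOURCED ORDER of the UNPENALISED dressed torus** —
every unit ground state `φ₀` of `H_U + dressing` (penalty `0`; source `h = c_λ ε² m⋆²/256`, charging
`κ = 4(4+U+|μ|)²/(c_λ ε² m⋆²)`) has `Re ⟨φ₀, Δ φ₀⟩ ≥ m⋆ L²`. No window term at all: Anderson's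
canonical pair amplitude in quasi-average dress. -/
def ChargedSourcedOrderAt (U δ μ mstar cl ε : ℝ) (L : ℕ) [NeZero L] : Prop :=
  ∀ φ₀ : Fock (Orb (FermionTorus 2 L)), star φ₀ ⬝ᵥ φ₀ = 1 →
    (star φ₀ ⬝ᵥ dressedHubbard L U (2 * ⌊(1 - δ) * (L : ℝ) ^ 2 / 2⌋₊) μ
          (4 * (4 + U + |μ|) ^ 2 / (cl * ε ^ 2 * mstar ^ 2)) (cl * ε ^ 2 * mstar ^ 2 / 256) 0 ε *ᵥ φ₀).re =
      (dressedHubbard L U (2 * ⌊(1 - δ) * (L : ℝ) ^ 2 / 2⌋₊) μ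
          (4 * (4 + U + |μ|) ^ 2 / (cl * ε ^ 2 * mstar ^ 2)) (cl * ε ^ 2 * mstar ^ 2 / 256) 0 ε).minEnergyOn ⊤ →
    mstar * (L : ℝ) ^ 2 ≤ (star φ₀ ⬝ᵥ pairField dWaveFormFactor L *ᵥ φ₀).re

/-- **Split stub (S-A2) at size `L`: NO WINDOW KINK** — between a ground state `φ₀` of the
unpenalised dressed torus and a ground state `φ` of the dressed torus with penalty `λ = c_λ ε²`
(same source and charging), the window weight drops by at most `m⋆² L²/2`: no first-order jump of
`⟨W_ε⟩` under an infinitesimal U(1)-invariant window repulsion (boost/collapse excluded — the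
stiffness content, isolated). -/
def NoWindowKinkAt (U δ μ mstar cl ε : ℝ) (L : ℕ) [NeZero L] : Prop :=
  ∀ φ₀ : Fock (Orb (FermionTorus 2 L)), star φ₀ ⬝ᵥ φ₀ = 1 →
    (star φ₀ ⬝ᵥ dressedHubbard L U (2 * ⌊(1 - δ) * (L : ℝ) ^ 2 / 2⌋₊) μ
          (4 * (4 + U + |μ|) ^ 2 / (cl * ε ^ 2 * mstar ^ 2)) (cl * ε ^ 2 * mstar ^ 2 / 256) 0 ε *ᵥ φ₀).re =
      (dressedHubbard L U (2 * ⌊(1 - δ) * (L : ℝ) ^ 2 / 2⌋₊) μ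
          (4 * (4 + U + |μ|) ^ 2 / (cl * ε ^ 2 * mstar ^ 2)) (cl * ε ^ 2 * mstar ^ 2 / 256) 0 ε).minEnergyOn ⊤ →
    ∀ φ : Fock (Orb (FermionTorus 2 L)), star φ ⬝ᵥ φ = 1 →
      (star φ ⬝ᵥ dressedHubbard L U (2 * ⌊(1 - δ) * (L : ℝ) ^ 2 / 2⌋₊) μ
            (4 * (4 + U + |μ|) ^ 2 / (cl * ε ^ 2 * mstar ^ 2)) (cl * ε ^ 2 * mstar ^ 2 / 256)
            (cl * ε ^ 2) ε *ᵥ φ).re =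
        (dressedHubbard L U (2 * ⌊(1 - δ) * (L : ℝ) ^ 2 / 2⌋₊) μ
            (4 * (4 + U + |μ|) ^ 2 / (cl * ε ^ 2 * mstar ^ 2)) (cl * ε ^ 2 * mstar ^ 2 / 256)
            (cl * ε ^ 2) ε).minEnergyOn ⊤ →
      (star φ₀ ⬝ᵥ kacWindow L ε *ᵥ φ₀).re - (star φ ⬝ᵥ kacWindow L ε *ᵥ φ).re ≤
        mstar ^ 2 / 2 * (L : ℝ) ^ 2

/-- Composition shape of the SPLIT variant (for crux-plan): `splitBridge` with `k = m⋆² L²/2` gives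
`gap ≥ λ m⋆² L²/2 - 8√2 h L² - (4+U+|μ|)² L²/(4κ) = λ m⋆² L² (1/2 - √2/32 - 1/16)` and the crux with
`a = m⋆²/4` once `Cε ≤ m⋆²/8`. -/
def SplitTransfer : Prop :=
  (∀ U : ℝ, ChargingFloor U) → SourceRemoval →
    (∃ U : ℝ, 0 < U ∧ ∃ δ ∈ Set.Ioo (0 : ℝ) (1 / 2), ∃ μ mstar cl ε₁ : ℝ, 0 < mstar ∧ 0 < cl ∧ 0 < ε₁ ∧
      ∀ ε ∈ Set.Ioc (0 : ℝ) ε₁, ∃ L₀ : ℕ, ∀ (L : ℕ) [NeZero L], L₀ ≤ L → Even L →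
        ChargedSourcedOrderAt U δ μ mstar cl ε L ∧ NoWindowKinkAt U δ μ mstar cl ε L) →
      WindowGap

end Concrete

/-! ### Kernel-checked bookkeeping of the constants -/

/-- **Bookkeeping (PROVED).** With penalty `λ`, order floor `m`, source `h = λ m²/64`, charging
`κ = b²/(λ m²)` (`b = 4 + U + |μ| > 0`), the three-term floor delivered by `dressedBridge` +
`SourceRemoval` + `ChargingFloor`, namely `gap ≥ λ m² L² - 8√2 h L² - b² L²/(4κ)`, gives the crux
inequality `λ (Cε + a) L² ≤ gap` with `a = m²/4` as soon as `Cε ≤ m²/4`. -/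
theorem bookkeeping (lam m Lsq C ε gap b : ℝ) (hlam : 0 < lam) (hm : 0 < m) (hL : 0 ≤ Lsq)
    (hb : 0 < b) (hCε : C * ε ≤ m ^ 2 / 4)
    (hgap : lam * m ^ 2 * Lsq - 8 * Real.sqrt 2 * (lam * m ^ 2 / 64) * Lsq
        - b ^ 2 * Lsq / (4 * (b ^ 2 / (lam * m ^ 2))) ≤ gap) :
    lam * (C * ε + m ^ 2 / 4) * Lsq ≤ gap := by
  have hs : Real.sqrt 2 ^ 2 = 2 := Real.sq_sqrt (by norm_num)
  have hn : 0 ≤ Real.sqrt 2 := Real.sqrt_nonneg 2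
  have hs2 : Real.sqrt 2 ≤ 2 := by nlinarith
  have hκ : b ^ 2 * Lsq / (4 * (b ^ 2 / (lam * m ^ 2))) = lam * m ^ 2 * Lsq / 4 := by
    field_simp
  rw [hκ] at hgap
  have h1 : lam * (C * ε + m ^ 2 / 4) * Lsq ≤ lam * (m ^ 2 / 2) * Lsq := by
    have : C * ε + m ^ 2 / 4 ≤ m ^ 2 / 2 := by linarith
    have := mul_le_mul_of_nonneg_left this hlam.le
    exact mul_le_mul_of_nonneg_right this hL
  have hmL : 0 ≤ lam * m ^ 2 * Lsq := by positivity
  nlinarith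


end Summit.HubbardSuperconductivity.HubbardSuperconductivity.Cruxes.WindowGap.SectorInvisibleDressing
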